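import Mathlib
import Summits.AtomisticToContinuum.HydrodynamicLimit.Theorems.InformationPercolationEngineKickFairRelEquilibriumMesoKeyCount
import Summits.AtomisticToContinuum.HydrodynamicLimit.Theorems.InformationPercolationEngineKickFairRelEquilibriumMesoEnergyTail
import Summits.AtomisticToContinuum.HydrodynamicLimit.Theorems.InformationPercolationEngineKickFairRelEquilibriumMesoPinchTransfer
import HarnessLib

/-!
# `KickFairRelEquilibriumMeso`, line `Sketch` — stub RU (`stub_restartDeviationCut`) at RUNG 0, part 2 (converse):
# RU at constant profiles gives the unconditional window large-deviation bound under the invariant law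

Helper file (`--supports stmt-AtomisticToContinuum-15177`) of the line lead (c5) for the registered stub
`stub_restartDeviationCut` (RU) of the skeleton `Cruxes/KickFairRelEquilibriumMeso/Lines/Sketch.lean` (rev 10/11);
registered sub-goal `windowLD_of_restartDeviationCut_rung0`, the converse of `restartDeviationCut_rung0_of_windowLD`
(file `…MesoRungZeroWindowLD.lean`). Together the two identify the EQUILIBRIUM content of RU exactly.

At RUNG 0 (constant profiles `a₀ ≡ 1, u₀ ≡ 0, θ₀ ≡ 1`, `LG = G = localGibbsLaw σ 1 0 1 N Φ`) RU says: on every level set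
`B = {cellKey = cellKey z₀}` of the time-zero key with `G(B) ≥ e^{-η(N+1)}`,
`G(B ∩ {|Z| > t_N/L}) ≤ e^{-c(N+1)} G(B)` for the cut windowed centred kick sum `Z = slotSum …`. This implies the
UNCONDITIONAL bound `G({|Z| > t_N/L}) ≤ e^{-c'(N+1)}` eventually: split the deviation event `E` along the key.
* hot configurations `{KE > K(N+1)}` carry `G`-mass `≤ e^{-(N+1)}` (E2 = `stub_energyTail` at temperature `1`, rate `1`;
  needs `σ < 1/2`, whence the threshold `min σ₀ (1/2)`);
* the keys of the configurations with `KE ≤ K(N+1)` lie in a finite set `s_N` of cardinality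
  `≤ exp(C_K (N+1)^{3/4} log(N+2))` (KC = `stub_keyCount`);
* for each key `k ∈ s_N`, the level set `B_k` is either typical (`G(B_k) ≥ e^{-η(N+1)}`, and RU gives
  `G(B_k ∩ E) ≤ e^{-c(N+1)} G(B_k) ≤ e^{-c(N+1)}`, `G` being a probability measure) or atypical
  (`G(B_k ∩ E) ≤ G(B_k) < e^{-η(N+1)}`).
Hence `G(E) ≤ e^{-(N+1)} + #s_N (e^{-c(N+1)} + e^{-η(N+1)}) ≤ e^{-(N+1)} + 2 exp(C_K (N+1)^{3/4} log(N+2) − m(N+1))`,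
`m = min c η`, which is `≤ e^{-c'(N+1)}` eventually for `c' = min m 1 / 2` (`tendsto_exp_keyEntropy_sub`).

References: C. Cercignani, R. Illner, M. Pulvirenti, *The Mathematical Theory of Dilute Gases* (1994), App. 4.A
(the invariant law); the line card `Cruxes/KickFairRelEquilibriumMeso/Ideas/two-time-pinch.md`.
-/

noncomputable section

open MeasureTheory Set Filter Topology
open scoped ENNReal Classical

namespace Summit.AtomisticToContinuum.HydrodynamicLimit.Theorems.KickFairRelEquilibriumMesoLine

open Literature.Analysis.FluidPDE Literature.MathematicalPhysics.KineticTheory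

/-- **The rates of the converse.** For `0 < c' < m` and `c' < 1`,
`e^{-(1-c')(N+1)} + 2 exp(C (N+1)^{3/4} log(N+2) − (m − c')(N+1)) → 0`. [folklore] -/
theorem tendsto_rungZero_errorTerm (C : ℝ) {m c' : ℝ} (hc'm : c' < m) (hc'1 : c' < 1) :
    Tendsto (fun N : ℕ => Real.exp (-((1 - c') * ((N : ℝ) + 1))) +
      2 * Real.exp (C * ((N : ℝ) + 1) ^ (3 / 4 : ℝ) * Real.log ((N : ℝ) + 2) - (m - c') * ((N : ℝ) + 1)))
      atTop (𝓝 0) := by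
  have h1 : Tendsto (fun N : ℕ => Real.exp (-((1 - c') * ((N : ℝ) + 1)))) atTop (𝓝 0) := by
    have h := tendsto_exp_keyEntropy_sub 0 (b := 1 - c') (by linarith)
    refine h.congr fun N => ?_
    rw [zero_mul, zero_mul, zero_sub]
  have h2 := (tendsto_exp_keyEntropy_sub C (b := m - c') (by linarith)).const_mul 2
  have h := h1.add h2
  rw [mul_zero, add_zero] at h
  exact h

/-- **The arithmetic of the converse.** If `#s ≤ exp(C φ_N)` (`φ_N = (N+1)^{3/4} log(N+2)`), `m ≤ c`, `m ≤ η` and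
the error term of `tendsto_rungZero_errorTerm` at `N` is `≤ 1`, then
`e^{-(N+1)} + #s (e^{-c(N+1)} + e^{-η(N+1)}) ≤ e^{-c'(N+1)}`. [folklore] -/
theorem rungZero_real_bound {C m c' c η S : ℝ} {N : ℕ}
    (hS : S ≤ Real.exp (C * ((N : ℝ) + 1) ^ (3 / 4 : ℝ) * Real.log ((N : ℝ) + 2)))
    (hmc : m ≤ c) (hmη : m ≤ η)
    (hF : Real.exp (-((1 - c') * ((N : ℝ) + 1))) +
      2 * Real.exp (C * ((N : ℝ) + 1) ^ (3 / 4 : ℝ) * Real.log ((N : ℝ) + 2) - (m - c') * ((N : ℝ) + 1)) ≤ 1) :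
    Real.exp (-((N : ℝ) + 1)) +
        S * (Real.exp (-(c * ((N : ℝ) + 1))) + Real.exp (-(η * ((N : ℝ) + 1)))) ≤
      Real.exp (-(c' * ((N : ℝ) + 1))) := by
  have hN0 : (0 : ℝ) ≤ (N : ℝ) + 1 := by positivity
  have hb : Real.exp (-(c * ((N : ℝ) + 1))) ≤ Real.exp (-(m * ((N : ℝ) + 1))) :=
    Real.exp_le_exp.2 (neg_le_neg (mul_le_mul_of_nonneg_right hmc hN0))
  have hd : Real.exp (-(η * ((N : ℝ) + 1))) ≤ Real.exp (-(m * ((N : ℝ) + 1))) :=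
    Real.exp_le_exp.2 (neg_le_neg (mul_le_mul_of_nonneg_right hmη hN0))
  have e1 : Real.exp (-(c' * ((N : ℝ) + 1))) * Real.exp (-((1 - c') * ((N : ℝ) + 1))) =
      Real.exp (-((N : ℝ) + 1)) := by
    rw [← Real.exp_add]
    congr 1
    ring
  have e2 : Real.exp (-(c' * ((N : ℝ) + 1))) *
      Real.exp (C * ((N : ℝ) + 1) ^ (3 / 4 : ℝ) * Real.log ((N : ℝ) + 2) - (m - c') * ((N : ℝ) + 1)) =
      Real.exp (C * ((N : ℝ) + 1) ^ (3 / 4 : ℝ) * Real.log ((N : ℝ) + 2)) *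
        Real.exp (-(m * ((N : ℝ) + 1))) := by
    rw [← Real.exp_add, ← Real.exp_add]
    congr 1
    ring
  calc Real.exp (-((N : ℝ) + 1)) +
        S * (Real.exp (-(c * ((N : ℝ) + 1))) + Real.exp (-(η * ((N : ℝ) + 1))))
      ≤ Real.exp (-((N : ℝ) + 1)) +
        Real.exp (C * ((N : ℝ) + 1) ^ (3 / 4 : ℝ) * Real.log ((N : ℝ) + 2)) *
          (Real.exp (-(m * ((N : ℝ) + 1))) + Real.exp (-(m * ((N : ℝ) + 1)))) :=
        add_le_add le_rfl (mul_le_mul hS (add_le_add hb hd) (by positivity) (by positivity))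
    _ = Real.exp (-(c' * ((N : ℝ) + 1))) * Real.exp (-((1 - c') * ((N : ℝ) + 1))) +
          2 * (Real.exp (-(c' * ((N : ℝ) + 1))) *
            Real.exp (C * ((N : ℝ) + 1) ^ (3 / 4 : ℝ) * Real.log ((N : ℝ) + 2) - (m - c') * ((N : ℝ) + 1))) := by
        rw [e1, e2]
        ring
    _ = Real.exp (-(c' * ((N : ℝ) + 1))) * (Real.exp (-((1 - c') * ((N : ℝ) + 1))) +
          2 * Real.exp (C * ((N : ℝ) + 1) ^ (3 / 4 : ℝ) * Real.log ((N : ℝ) + 2) -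
            (m - c') * ((N : ℝ) + 1))) := by ring
    _ ≤ Real.exp (-(c' * ((N : ℝ) + 1))) * 1 :=
        mul_le_mul_of_nonneg_left hF (Real.exp_pos _).le
    _ = Real.exp (-(c' * ((N : ℝ) + 1))) := mul_one _

/-- **WLD from RU at rung 0 (registered sub-goal `windowLD_of_restartDeviationCut_rung0`, the converse of
`restartDeviationCut_rung0_of_windowLD`).** If the restart deviation stub RU holds at constant profiles `(1, 0, 1)`
(conditional bound `G(B ∩ E) ≤ e^{-c(N+1)} G(B)` on `G`-typical level sets `B` of the time-zero key,
`G = localGibbsLaw σ 1 0 1 N (Φ N)` the invariant law, `E = {|Z| > t_N/L}` the deviation event of the cut windowed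
centred kick sum), then the unconditional window large-deviation bound `G(E) ≤ e^{-c'(N+1)}` holds eventually,
uniformly over cut weights and kinetic windows, for `σ < min σ₀ (1/2)`: split `E` along the key, pay the hot
configurations by E2 (`stub_energyTail`), the atypical level sets by `e^{-η(N+1)}` each and the typical ones by RU,
and count the level sets of bounded energy by KC (`stub_keyCount`); see the module docstring. [folklore] -/
theorem windowLD_of_restartDeviationCut_rung0 :
    (∃ σ₀ : ℝ, 0 < σ₀ ∧ ∀ σ : ℝ, 0 < σ → σ < σ₀ → ∀ Φ : (N : ℕ) → Flow σ N, ∀ τ : ℝ, 0 < τ →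
    ∀ g : V3 × V3 × V3 → ℝ, Continuous g → (∃ C : ℝ, ∀ p, |g p| ≤ C) →
    ∀ L : ℝ, 0 < L → ∀ A : ℝ, 0 < A →
    ∃ c : ℝ, 0 < c ∧ ∃ η : ℝ, 0 < η ∧ ∃ N₀ : ℕ, ∀ N : ℕ, N₀ ≤ N →
    ∀ h : Fin (N + 1) → ℕ → Past N → ℝ, (∀ i n, Measurable (h i n)) → (∀ i n p, |h i n p| ≤ 1) →
    (∀ i n p, p.2.2.2 - p.2.1 < tN N / A → h i n p = 0) →
    ∀ t₁ t₂ : ℝ, 0 ≤ t₁ → t₁ ≤ t₂ → t₂ ≤ τ → t₂ ≤ t₁ + tN N →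
    ∀ z₀ : Phase N,
    ENNReal.ofReal (Real.exp (-(η * ((N : ℝ) + 1)))) ≤
        localGibbsLaw σ (fun _ => 1) (fun _ => 0) (fun _ => 1) N (Φ N)
          {z | cellKey (rs N) (rs N) z = cellKey (rs N) (rs N) z₀} →
      localGibbsLaw σ (fun _ => 1) (fun _ => 0) (fun _ => 1) N (Φ N)
          ({z | cellKey (rs N) (rs N) z = cellKey (rs N) (rs N) z₀} ∩
            {z | tN N / L < |slotSum (Φ N) τ (rs N) t₁ t₂ g h z|}) ≤
        ENNReal.ofReal (Real.exp (-(c * ((N : ℝ) + 1)))) *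
          localGibbsLaw σ (fun _ => 1) (fun _ => 0) (fun _ => 1) N (Φ N)
            {z | cellKey (rs N) (rs N) z = cellKey (rs N) (rs N) z₀}) →
    ∃ σ₀ : ℝ, 0 < σ₀ ∧ ∀ σ : ℝ, 0 < σ → σ < σ₀ → ∀ Φ : (N : ℕ) → Flow σ N, ∀ τ : ℝ, 0 < τ →
    ∀ g : V3 × V3 × V3 → ℝ, Continuous g → (∃ C : ℝ, ∀ p, |g p| ≤ C) →
    ∀ L : ℝ, 0 < L → ∀ A : ℝ, 0 < A →
    ∃ c : ℝ, 0 < c ∧ ∃ N₀ : ℕ, ∀ N : ℕ, N₀ ≤ N →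
    ∀ h : Fin (N + 1) → ℕ → Past N → ℝ, (∀ i n, Measurable (h i n)) → (∀ i n p, |h i n p| ≤ 1) →
    (∀ i n p, p.2.2.2 - p.2.1 < tN N / A → h i n p = 0) →
    ∀ t₁ t₂ : ℝ, 0 ≤ t₁ → t₁ ≤ t₂ → t₂ ≤ τ → t₂ ≤ t₁ + tN N →
    localGibbsLaw σ (fun _ => 1) (fun _ => 0) (fun _ => 1) N (Φ N)
        {z | tN N / L < |slotSum (Φ N) τ (rs N) t₁ t₂ g h z|} ≤
      ENNReal.ofReal (Real.exp (-(c * ((N : ℝ) + 1)))) := by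
  rintro ⟨σ₀, hσ₀, hRU⟩
  refine ⟨min σ₀ (1 / 2), lt_min hσ₀ one_half_pos, fun σ hσ hσlt Φ τ hτ g hg hgb L hL A hA => ?_⟩
  have hσ₀' : σ < σ₀ := hσlt.trans_le (min_le_left _ _)
  have hσ2 : σ < 1 / 2 := hσlt.trans_le (min_le_right _ _)
  obtain ⟨c, hc, η, hη, N₀, hN⟩ := hRU σ hσ hσ₀' Φ τ hτ g hg hgb L hL A hA
  -- E2 at temperature `1` and rate `1`; KC at the cap `max K 0`
  obtain ⟨K, N₁, hE2⟩ := stub_energyTail 1 one_pos 1 zero_le_one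
  obtain ⟨CK, hKC⟩ := stub_keyCount (max K 0) (le_max_right _ _)
  -- the rates
  set m : ℝ := min c η with hm
  have hm0 : 0 < m := lt_min hc hη
  set c' : ℝ := min m 1 / 2 with hc'
  have hmin0 : 0 < min m 1 := lt_min hm0 one_pos
  have hc'0 : 0 < c' := by positivity
  have hc'm : c' < m := by
    have := min_le_left m 1
    rw [hc']
    linarith
  have hc'1 : c' < 1 := by
    have := min_le_right m 1
    rw [hc']
    linarith
  -- the threshold in `N`
  obtain ⟨N₂, hN₂⟩ := eventually_atTop.1
    ((tendsto_rungZero_errorTerm CK hc'm hc'1).eventually_le_const one_pos)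
  refine ⟨c', hc'0, max N₀ (max N₁ N₂), fun N hN' h hhm hhb hcut t₁ t₂ h0 h12 h2τ hwin => ?_⟩
  have hN₀ : N₀ ≤ N := le_trans (le_max_left _ _) hN'
  have hN₁ : N₁ ≤ N := le_trans ((le_max_left _ _).trans (le_max_right _ _)) hN'
  have hN₂' : N₂ ≤ N := le_trans ((le_max_right _ _).trans (le_max_right _ _)) hN'
  obtain ⟨s, hcard, hmem⟩ := hKC N
  have hhot := hE2 N hN₁ σ hσ hσ2 (Φ N)
  have hRUN := hN N hN₀ h hhm hhb hcut t₁ t₂ h0 h12 h2τ hwin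
  haveI : IsProbabilityMeasure (localGibbsLaw σ (fun _ => 1) (fun _ => 0) (fun _ => 1) N (Φ N)) :=
    isProbabilityMeasure_localGibbsLaw continuous_const continuous_const continuous_const
      (fun _ => one_pos) (fun _ => one_pos) hσ2.le N (Φ N)
  set G := localGibbsLaw σ (fun _ => 1) (fun _ => 0) (fun _ => 1) N (Φ N) with hG
  set E : Set (Phase N) := {z | tN N / L < |slotSum (Φ N) τ (rs N) t₁ t₂ g h z|} with hEdef
  set H : Set (Phase N) := {z | max K 0 * ((N : ℝ) + 1) < kinEnergy z} with hHdef
  -- the deviation event split along the key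
  have hcover : E ⊆ H ∪ ⋃ k ∈ s, ({z | cellKey (rs N) (rs N) z = k} ∩ E) := by
    intro z hz
    by_cases hKz : kinEnergy z ≤ max K 0 * ((N : ℝ) + 1)
    · refine Or.inr (mem_iUnion₂.2 ⟨cellKey (rs N) (rs N) z, hmem z hKz, ?_, hz⟩)
      simp only [mem_setOf_eq]
    · exact Or.inl (not_le.1 hKz)
  -- hot configurations
  have hHle : G H ≤ ENNReal.ofReal (Real.exp (-((N : ℝ) + 1))) := by
    have hsub : H ⊆ {z | K * ((N : ℝ) + 1) < kinEnergy z} := by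
      intro z hz
      simp only [hHdef, mem_setOf_eq] at hz ⊢
      refine lt_of_le_of_lt ?_ hz
      exact mul_le_mul_of_nonneg_right (le_max_left _ _) (by positivity)
    refine (measure_mono hsub).trans ?_
    simpa only [one_mul] using hhot
  -- one level set of the key: typical (RU) or atypical
  have hkey : ∀ k ∈ s, G ({z | cellKey (rs N) (rs N) z = k} ∩ E) ≤
      ENNReal.ofReal (Real.exp (-(c * ((N : ℝ) + 1)))) +
        ENNReal.ofReal (Real.exp (-(η * ((N : ℝ) + 1)))) := by
    intro k _
    by_cases hk : ∃ z₀ : Phase N, cellKey (rs N) (rs N) z₀ = k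
    · obtain ⟨z₀, rfl⟩ := hk
      rcases le_or_gt (ENNReal.ofReal (Real.exp (-(η * ((N : ℝ) + 1)))))
        (G {z | cellKey (rs N) (rs N) z = cellKey (rs N) (rs N) z₀}) with hB | hB
      · calc G ({z | cellKey (rs N) (rs N) z = cellKey (rs N) (rs N) z₀} ∩ E)
            ≤ ENNReal.ofReal (Real.exp (-(c * ((N : ℝ) + 1)))) *
                G {z | cellKey (rs N) (rs N) z = cellKey (rs N) (rs N) z₀} := hRUN z₀ hB
          _ ≤ ENNReal.ofReal (Real.exp (-(c * ((N : ℝ) + 1)))) * 1 :=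
              mul_le_mul' le_rfl prob_le_one
          _ ≤ _ := by
              rw [mul_one]
              exact le_self_add
      · calc G ({z | cellKey (rs N) (rs N) z = cellKey (rs N) (rs N) z₀} ∩ E)
            ≤ G {z | cellKey (rs N) (rs N) z = cellKey (rs N) (rs N) z₀} := measure_mono inter_subset_left
          _ ≤ ENNReal.ofReal (Real.exp (-(η * ((N : ℝ) + 1)))) := hB.le
          _ ≤ _ := le_add_self
    · have hsub : {z : Phase N | cellKey (rs N) (rs N) z = k} ∩ E ⊆ ∅ := fun z hz => hk ⟨z, hz.1⟩
      calc G ({z | cellKey (rs N) (rs N) z = k} ∩ E) ≤ G ∅ := measure_mono hsub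
        _ = 0 := measure_empty
        _ ≤ _ := zero_le
  -- assembling
  have hsum : G E ≤ ENNReal.ofReal (Real.exp (-((N : ℝ) + 1))) +
      (s.card : ℝ≥0∞) * (ENNReal.ofReal (Real.exp (-(c * ((N : ℝ) + 1)))) +
        ENNReal.ofReal (Real.exp (-(η * ((N : ℝ) + 1))))) := by
    calc G E ≤ G (H ∪ ⋃ k ∈ s, ({z | cellKey (rs N) (rs N) z = k} ∩ E)) := measure_mono hcover
      _ ≤ G H + G (⋃ k ∈ s, ({z | cellKey (rs N) (rs N) z = k} ∩ E)) := measure_union_le _ _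
      _ ≤ G H + ∑ k ∈ s, G ({z | cellKey (rs N) (rs N) z = k} ∩ E) :=
          add_le_add le_rfl (measure_biUnion_finset_le _ _)
      _ ≤ ENNReal.ofReal (Real.exp (-((N : ℝ) + 1))) +
            ∑ k ∈ s, (ENNReal.ofReal (Real.exp (-(c * ((N : ℝ) + 1)))) +
              ENNReal.ofReal (Real.exp (-(η * ((N : ℝ) + 1))))) :=
          add_le_add hHle (Finset.sum_le_sum fun k hk => hkey k hk)
      _ = _ := by rw [Finset.sum_const, nsmul_eq_mul]
  have hreal := rungZero_real_bound (c' := c') hcard (min_le_left c η) (min_le_right c η) (hN₂ N hN₂')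
  calc G E ≤ ENNReal.ofReal (Real.exp (-((N : ℝ) + 1))) +
      (s.card : ℝ≥0∞) * (ENNReal.ofReal (Real.exp (-(c * ((N : ℝ) + 1)))) +
        ENNReal.ofReal (Real.exp (-(η * ((N : ℝ) + 1))))) := hsum
    _ = ENNReal.ofReal (Real.exp (-((N : ℝ) + 1)) +
        (s.card : ℝ) * (Real.exp (-(c * ((N : ℝ) + 1))) + Real.exp (-(η * ((N : ℝ) + 1))))) := by
        rw [ENNReal.ofReal_add (Real.exp_pos _).le (by positivity), ENNReal.ofReal_mul (Nat.cast_nonneg _),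
          ENNReal.ofReal_natCast, ENNReal.ofReal_add (Real.exp_pos _).le (Real.exp_pos _).le]
    _ ≤ ENNReal.ofReal (Real.exp (-(c' * ((N : ℝ) + 1)))) := ENNReal.ofReal_le_ofReal hreal

end Summit.AtomisticToContinuum.HydrodynamicLimit.Theorems.KickFairRelEquilibriumMesoLine

end
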